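import Summits.QuantumFields.BalabanUV.T4Continuum.Support.NE7NearFlatSharpSector
import Summits.QuantumFields.BalabanUV.T4Continuum.Support.NE3ClassSixFlatWitness
import HarnessLib

/-!
# NE7NearFlatSharpSectorLift — part 4 read in F28's own currency: a datum carrying a FLAT admissible lift (the hypothesis `h0` of
# `NE7OneStepOfSectorApeRep.oneStep_of_path_ape_repWgauge`) is flat, so no F28-path of small data from such a datum ends at the unit-flux datum

Cell `pub-balaban`, rung (B)+1 sub-cell t4, lineage `b2b-balaban-t4-ne7b-p1` (row NE7b OWNER + CRUX PROVER), generation 157; junction census for the NE7 road's located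
gap (G1) of `t4/b2b-balaban-t4-ne7-p1-g113/ROAD-G113.md` §6, appendix to part 4 (`NE7NearFlatSharpSector`).  F28's path END starts from a datum `γ 0` over which
SOME admissible configuration `U₀ ∈ admissible (sfClass d L N ε) L (k+1) (γ 0)` has `SmallField U₀ 0`; this file checks that such a datum is flat (a zero-curvature
`U(n)`-valued configuration on `ℤ^d` is a pure gauge, `NE3EnergyRateFlatClass.exists_unitary_gauge_eq_gaugeAct_flatCfg`, and the `(k+1)`-fold average of a pure
gauge is a pure gauge, `avgIter_gaugeAct_flatCfg`), and restates part 4's obstruction with `h0` in place of «`γ 0` flat».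
WHAT ([folklore]; 0 def, 0 sorry).  `hol_plaqWord_eq_one_of_smallField_zero`, **`flat_of_flat_admissible_lift`** (with `NE3ClassSixFlatWitness.hol_gaugeAct_flatCfg_plaqWord`), **`no_admissible_path_to_unitFlux`** (`N ≥ 4`,
any `L`, `ε`, `k`: the unit-flux datum of `NE7NearFlatSharpSector.no_path_from_flat_to_unitFlux` is the endpoint of NO map `γ : ℝ → configurations`, continuous on
`[0,1]`, with `N`-periodic `r`-small values (`r < 1`) and `γ 0` carrying a flat admissible lift).
HONEST FRAMING (page 1): bookkeeping between part 4 and F28's hypothesis list; F28∕F29∕the road's ENDs∕`hsector` untouched; nothing of Bałaban's asserted; NE3∕NE7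
NOT proved; row NE7b (`T4WeightBudget.RelWeightBound`) NOT PRINTED ∕ NOT PROVED; spine count = dagwriter's call; finite T⁴ rung (B)+1 — NOT infinite volume, NOT mass
gap, NOT BetaPertH, NOT Clay (continuum YM on T⁴ ⇐ BetaPertH ∧ nine spine estimates).
-/

set_option autoImplicit false

open scoped BigOperators Matrix Matrix.Norms.L2Operator
open Finset NormedSpace Complex Set

namespace Summit.QuantumFields.BalabanUV.T4Continuum.NE7NearFlatSharpSectorLift

open Literature.MathematicalPhysics.QuantumFieldTheory.Balaban1983to89
open B7Prop1Explicit B7Prop2Explicit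
open T4AveragingDeficitWall hiding Site Plane Plaq Bond
open T4AveragingDeficitWallBoundary (IsPeriodicCfg)
open MinimalActionSandwich (admissible)
open MinimalActionRate (sfClass)
open MinimalActionWitness (flatCfg)
open NE3EnergyRateFlatClass (exists_unitary_gauge_eq_gaugeAct_flatCfg avgIter_gaugeAct_flatCfg)
open NE7NearFlatSharpSector (no_path_from_flat_to_unitFlux)
open NE3ClassSixFlatWitness (hol_gaugeAct_flatCfg_plaqWord)

noncomputable section

variable {d : ℕ} {n : Type*} [Fintype n] [DecidableEq n]

/-- Radius `0` means every plaquette variable is `1`. [folklore] -/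
theorem hol_plaqWord_eq_one_of_smallField_zero {U : Site d → Fin d → (Matrix n n ℂ)ˣ} (hU : SmallField U 0) (x : Site d) {κ μ : Fin d} (hκμ : κ ≠ μ) :
    hol U x (plaqWord κ μ) = 1 := by
  have h := hU x κ μ hκμ
  have h1 : ((hol U x (plaqWord κ μ) : (Matrix n n ℂ)ˣ) : Matrix n n ℂ) = 1 := sub_eq_zero.mp (norm_le_zero_iff.mp h)
  exact Units.ext h1

/-- **A DATUM WITH A FLAT ADMISSIBLE LIFT IS FLAT**: if `U₀ ∈ admissible (sfClass d L N ε) L k D` has `SmallField U₀ 0` then every plaquette variable of `D` is `1`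
(`U₀` is a pure gauge on `ℤ^d`, and so is its `k`-fold average `D`; for `κ = μ` the word is trivially closed too). [folklore] -/
theorem flat_of_flat_admissible_lift [Nonempty n] {L N : ℕ} {ε : ℝ} {k : ℕ} {D U₀ : Site d → Fin d → (Matrix n n ℂ)ˣ}
    (hU₀ : U₀ ∈ admissible (sfClass d L N ε) L k D) (hflat : SmallField U₀ 0) (x : Site d) (κ μ : Fin d) :
    hol D x (plaqWord κ μ) = 1 := by
  obtain ⟨⟨hU₀u, -, -⟩, havg⟩ := hU₀
  obtain ⟨g, -, hg⟩ := exists_unitary_gauge_eq_gaugeAct_flatCfg hU₀u fun y κ' μ' h => hol_plaqWord_eq_one_of_smallField_zero hflat y h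
  rw [← havg, hg, avgIter_gaugeAct_flatCfg]
  exact hol_gaugeAct_flatCfg_plaqWord _ x κ μ

/-- **PART 4 IN F28's CURRENCY.**  For `N ≥ 4` there is a `U(n)`-valued `N`-periodic `U` on `ℤ⁴` with `SmallField U (2π∕N²)` such that for every `r < 1`, every
block size `L`, class radius `ε` and level `k`: NO map `γ : ℝ → configurations`, continuous on `[0,1]`, with every `γ τ` `N`-periodic and `SmallField (γ τ) r`,
whose initial datum `γ 0` carries a flat admissible lift `U₀ ∈ admissible (sfClass 4 L N ε) L k (γ 0)`, `SmallField U₀ 0` (the hypothesis `h0` of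
`NE7OneStepOfSectorApeRep.oneStep_of_path_ape_repWgauge`), has `γ 1 = U`. [folklore] -/
theorem no_admissible_path_to_unitFlux [Nonempty n] {N : ℕ} (hN : 4 ≤ N) :
    ∃ U : Site 4 → Fin 4 → (Matrix n n ℂ)ˣ, IsUnitaryCfg U ∧ IsPeriodicCfg U (N : ℤ) ∧ SmallField U (2 * Real.pi / (N : ℝ) ^ 2) ∧
      ∀ r : ℝ, r < 1 → ∀ (L : ℕ) (ε : ℝ) (k : ℕ) (γ : ℝ → (Site 4 → Fin 4 → (Matrix n n ℂ)ˣ)), ContinuousOn γ (Icc (0 : ℝ) 1) →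
        (∀ τ ∈ Icc (0 : ℝ) 1, IsPeriodicCfg (γ τ) (N : ℤ)) → (∀ τ ∈ Icc (0 : ℝ) 1, SmallField (γ τ) r) →
        (∃ U₀ : Site 4 → Fin 4 → (Matrix n n ℂ)ˣ, U₀ ∈ admissible (sfClass 4 L N ε) L k (γ 0) ∧ SmallField U₀ 0) → γ 1 ≠ U := by
  obtain ⟨U, hUu, hUP, hUs, hno⟩ := no_path_from_flat_to_unitFlux (n := n) hN
  refine ⟨U, hUu, hUP, hUs, fun r hr L ε k γ hγc hγP hγs ⟨U₀, hU₀, hU₀0⟩ => hno r hr γ hγc hγP hγs fun x κ μ _ => ?_⟩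
  exact flat_of_flat_admissible_lift hU₀ hU₀0 x κ μ

end

end Summit.QuantumFields.BalabanUV.T4Continuum.NE7NearFlatSharpSectorLift
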